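import Mathlib.Analysis.InnerProductSpace.Dual
import Mathlib.Analysis.LocallyConvex.Separation
import Mathlib.Analysis.Complex.Basic
import HarnessLib

/-!
# Density of unimodular linear combinations in a Hilbert space (Bagchi; Bayart–Matheron Prop. 11.10)

Topic `Literature/Analysis/OperatorTheory`. Everything in this file is PROVED. It is the
Hilbert-space-geometry step of Bagchi's proof of Voronin's universality theorem, in the form of
Bayart–Matheron, *Dynamics of Linear Operators*, §11.4:

**Proposition 11.10.** Let `H` be a Hilbert space and `(x_n)` a sequence in `H` such that
(1) `Σ_n |⟨x*, x_n⟩| = ∞` for every non-zero continuous linear functional `x*`, and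
(2) `Σ_n ‖x_n‖² < ∞`. Then the set `{Σ_{j<n} a_j x_j ; n ≥ 1, |a_j| = 1}` is dense in `H`.

* `exists_sum_Ico_smul_near` — Lemma 11.11 (Hahn–Banach): under (1), for every `N` the set
  `{Σ_{j=N}^{n} a_j x_j ; n ≥ N, |a_j| ≤ 1}` is dense;
* `exists_unimodular_norm_sq_le` — Lemma 11.12: coefficients `|a_j| ≤ 1` can be replaced by
  unimodular ones at cost `‖Σ a_j x_j − Σ b_j x_j‖² ≤ Σ ‖x_j‖²` (deterministic two-point averaging
  instead of the printed random signs: for one vector, the weighted mean over `b ∈ {u, −u}`,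
  `u = a/|a|`, with weights `(1 ± |a|)/2` is `‖w‖² + (1 − |a|²)‖x‖²`);
* `exists_unimodular_sum_near` — Proposition 11.10, with the extra freedom (visible in the printed
  proof) that the number of terms can be taken beyond any prescribed `N₀`.

Condition (1) is written for the Fréchet–Riesz representatives: `¬ Summable (‖⟪φ, x_n⟫‖)_n` for
every `φ ≠ 0`; sequences are indexed by `ℕ` and sums run over `Finset.range n`.

## References

* [BayartMatheron2009] F. Bayart, É. Matheron, *Dynamics of Linear Operators*, CUP 2009,
  Prop. 11.10, Lemmas 11.11, 11.12 (pp. 278–280).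
* [Steuding2007] J. Steuding, *Value-Distribution of L-Functions*, Lemmas 5.1–5.2, Thm. 5.4.
-/

noncomputable section

open scoped InnerProductSpace ComplexConjugate
open RCLike Filter Topology

namespace Literature.Analysis.OperatorTheory

namespace UnimodularCombinations

variable {H : Type*} [NormedAddCommGroup H] [InnerProductSpace ℂ H]

/-! ### Lemma 11.12: making the coefficients unimodular -/

/-- Expansion of `‖w + c • x‖²` in a complex inner product space. [folklore] -/
theorem norm_add_smul_sq (w x : H) (c : ℂ) :
    ‖w + c • x‖ ^ 2 = ‖w‖ ^ 2 + 2 * (c * ⟪w, x⟫_ℂ).re + ‖c‖ ^ 2 * ‖x‖ ^ 2 := by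
  rw [norm_add_sq (𝕜 := ℂ), inner_smul_right, norm_smul, mul_pow, RCLike.re_to_complex]

/-- **Two-point averaging.** For `|a| ≤ 1` there is a unimodular `b` (namely `u` or `−u`,
`u = a/|a|`) with `‖w + (a − b) • x‖² ≤ ‖w‖² + ‖x‖²`: the mean of the two choices with weights
`(1 ± |a|)/2` equals `‖w‖² + (1 − |a|²)‖x‖²`. [cite: BayartMatheron2009, Lemma 11.12] -/
theorem exists_unimodular_norm_add_smul_sq_le (w x : H) {a : ℂ} (ha : ‖a‖ ≤ 1) :
    ∃ b : ℂ, ‖b‖ = 1 ∧ ‖w + (a - b) • x‖ ^ 2 ≤ ‖w‖ ^ 2 + ‖x‖ ^ 2 := by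
  -- the direction `u` and the modulus `t`
  obtain ⟨u, t, hu, ht0, ht1, hatu⟩ : ∃ u : ℂ, ∃ t : ℝ, ‖u‖ = 1 ∧ 0 ≤ t ∧ t ≤ 1 ∧ a = t * u := by
    by_cases h0 : a = 0
    · exact ⟨1, 0, by simp, le_rfl, zero_le_one, by simp [h0]⟩
    · have hn : ‖a‖ ≠ 0 := norm_ne_zero_iff.2 h0
      have hn' : (‖a‖ : ℂ) ≠ 0 := by exact_mod_cast hn
      refine ⟨a / ‖a‖, ‖a‖, ?_, norm_nonneg _, ha, ?_⟩
      · rw [norm_div, Complex.norm_real, Real.norm_eq_abs, abs_of_nonneg (norm_nonneg _),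
          div_self hn]
      · rw [mul_div_cancel₀ _ hn']
  set R : ℝ := (u * ⟪w, x⟫_ℂ).re with hR
  -- the two candidates
  have hm : ‖w + (a - u) • x‖ ^ 2 = ‖w‖ ^ 2 + 2 * ((t - 1) * R) + (t - 1) ^ 2 * ‖x‖ ^ 2 := by
    have e : a - u = ((t - 1 : ℝ) : ℂ) * u := by rw [hatu]; push_cast; ring
    rw [norm_add_smul_sq, e, mul_assoc, Complex.re_ofReal_mul, norm_mul, Complex.norm_real, hu,
      mul_one, Real.norm_eq_abs, sq_abs]
  have hp : ‖w + (a - -u) • x‖ ^ 2 = ‖w‖ ^ 2 + 2 * ((t + 1) * R) + (t + 1) ^ 2 * ‖x‖ ^ 2 := by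
    have e : a - -u = ((t + 1 : ℝ) : ℂ) * u := by rw [hatu]; push_cast; ring
    rw [norm_add_smul_sq, e, mul_assoc, Complex.re_ofReal_mul, norm_mul, Complex.norm_real, hu,
      mul_one, Real.norm_eq_abs, sq_abs]
  -- their weighted mean is `‖w‖² + (1 - t²)‖x‖² ≤ ‖w‖² + ‖x‖²`
  have hkey : (1 + t) / 2 * ‖w + (a - u) • x‖ ^ 2 + (1 - t) / 2 * ‖w + (a - -u) • x‖ ^ 2 ≤
      ‖w‖ ^ 2 + ‖x‖ ^ 2 := by
    have hid : (1 + t) / 2 * ‖w + (a - u) • x‖ ^ 2 + (1 - t) / 2 * ‖w + (a - -u) • x‖ ^ 2 =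
        ‖w‖ ^ 2 + (1 - t ^ 2) * ‖x‖ ^ 2 := by
      rw [hm, hp]; ring
    rw [hid]
    nlinarith [mul_nonneg (sq_nonneg t) (sq_nonneg ‖x‖)]
  by_cases hle : ‖w + (a - u) • x‖ ^ 2 ≤ ‖w‖ ^ 2 + ‖x‖ ^ 2
  · exact ⟨u, hu, hle⟩
  · refine ⟨-u, by rw [norm_neg, hu], ?_⟩
    by_contra hgt
    have h1 : (1 + t) / 2 * (‖w‖ ^ 2 + ‖x‖ ^ 2) ≤ (1 + t) / 2 * ‖w + (a - u) • x‖ ^ 2 :=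
      mul_le_mul_of_nonneg_left (not_le.1 hle).le (by linarith)
    have h2 : (1 - t) / 2 * (‖w‖ ^ 2 + ‖x‖ ^ 2) ≤ (1 - t) / 2 * ‖w + (a - -u) • x‖ ^ 2 :=
      mul_le_mul_of_nonneg_left (not_le.1 hgt).le (by linarith)
    have h3 : (1 + t) / 2 * (‖w‖ ^ 2 + ‖x‖ ^ 2) < (1 + t) / 2 * ‖w + (a - u) • x‖ ^ 2 :=
      mul_lt_mul_of_pos_left (not_le.1 hle) (by linarith)
    linarith

/-- **Lemma 11.12 (deterministic form).** Given finitely many vectors `x_j` and coefficients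
`|a_j| ≤ 1`, there are unimodular `b_j` with `‖w + Σ_{j∈s} (a_j − b_j) x_j‖² ≤ ‖w‖² + Σ_{j∈s} ‖x_j‖²`
for any `w` (induction on `s`, one two-point averaging per vector).
[cite: BayartMatheron2009, Lemma 11.12] -/
theorem exists_unimodular_norm_add_sum_sq_le (x : ℕ → H) (a : ℕ → ℂ) (ha : ∀ j, ‖a j‖ ≤ 1)
    (s : Finset ℕ) (w : H) :
    ∃ b : ℕ → ℂ, (∀ j, ‖b j‖ = 1) ∧
      ‖w + ∑ j ∈ s, (a j - b j) • x j‖ ^ 2 ≤ ‖w‖ ^ 2 + ∑ j ∈ s, ‖x j‖ ^ 2 := by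
  classical
  induction s using Finset.induction_on generalizing w with
  | empty => exact ⟨fun _ ↦ 1, fun _ ↦ by simp, by simp⟩
  | insert i s hi ih =>
    obtain ⟨b₀, hb₀, hb₀le⟩ := ih w
    set w' : H := w + ∑ j ∈ s, (a j - b₀ j) • x j with hw'
    obtain ⟨bi, hbi, hbile⟩ := exists_unimodular_norm_add_smul_sq_le w' (x i) (ha i)
    refine ⟨Function.update b₀ i bi, fun j ↦ ?_, ?_⟩
    · rcases eq_or_ne j i with rfl | hj
      · rw [Function.update_self]; exact hbi
      · rw [Function.update_of_ne hj]; exact hb₀ j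
    · have hsum : ∑ j ∈ insert i s, (a j - Function.update b₀ i bi j) • x j =
          (a i - bi) • x i + ∑ j ∈ s, (a j - b₀ j) • x j := by
        rw [Finset.sum_insert hi, Function.update_self]
        congr 1
        refine Finset.sum_congr rfl fun j hj ↦ ?_
        rw [Function.update_of_ne (ne_of_mem_of_not_mem hj hi)]
      rw [hsum, Finset.sum_insert hi, show w + ((a i - bi) • x i + ∑ j ∈ s, (a j - b₀ j) • x j) =
        w' + (a i - bi) • x i by rw [hw']; abel]
      linarith

/-- **Lemma 11.12.** For vectors `x_j` and coefficients `|a_j| ≤ 1` there are unimodular `b_j` with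
`‖Σ_{j∈s} a_j x_j − Σ_{j∈s} b_j x_j‖² ≤ Σ_{j∈s} ‖x_j‖²`. [cite: BayartMatheron2009, Lemma 11.12] -/
theorem exists_unimodular_norm_sq_le (x : ℕ → H) (a : ℕ → ℂ) (ha : ∀ j, ‖a j‖ ≤ 1)
    (s : Finset ℕ) :
    ∃ b : ℕ → ℂ, (∀ j, ‖b j‖ = 1) ∧
      ‖∑ j ∈ s, a j • x j - ∑ j ∈ s, b j • x j‖ ^ 2 ≤ ∑ j ∈ s, ‖x j‖ ^ 2 := by
  obtain ⟨b, hb, h⟩ := exists_unimodular_norm_add_sum_sq_le x a ha s 0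
  refine ⟨b, hb, ?_⟩
  rw [zero_add, norm_zero, zero_pow two_ne_zero, zero_add] at h
  simpa only [sub_smul, Finset.sum_sub_distrib] using h

/-! ### Lemma 11.11: Hahn–Banach -/

variable [CompleteSpace H]

/-- **Lemma 11.11** (Hahn–Banach). If `Σ_n |⟪φ, x_n⟫| = ∞` for every `φ ≠ 0`, then for every `N`
the sums `Σ_{N ≤ j < n} a_j x_j` with `|a_j| ≤ 1` are dense: otherwise a separating functional
`φ` has `Σ_{N≤j<n} |⟪φ, x_j⟫| = Re ⟪φ, Σ a_j x_j⟫` bounded. [cite: BayartMatheron2009, Lemma 11.11] -/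
theorem exists_sum_Ico_smul_near (x : ℕ → H)
    (h1 : ∀ φ : H, φ ≠ 0 → ¬ Summable (fun n ↦ ‖⟪φ, x n⟫_ℂ‖)) (z : H) {ε : ℝ} (hε : 0 < ε)
    (N : ℕ) :
    ∃ n : ℕ, N ≤ n ∧ ∃ a : ℕ → ℂ, (∀ j, ‖a j‖ ≤ 1) ∧
      ‖z - ∑ j ∈ Finset.Ico N n, a j • x j‖ < ε := by
  classical
  by_contra hcon
  push Not at hcon
  -- the convex set of admissible sums
  set C : Set H := {y | ∃ n : ℕ, N ≤ n ∧ ∃ a : ℕ → ℂ, (∀ j, ‖a j‖ ≤ 1) ∧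
    y = ∑ j ∈ Finset.Ico N n, a j • x j} with hC
  -- padding a representation to a longer range
  have hpad : ∀ {n m : ℕ} (a : ℕ → ℂ), n ≤ m →
      ∑ j ∈ Finset.Ico N n, a j • x j =
        ∑ j ∈ Finset.Ico N m, (if j < n then a j else 0) • x j := by
    intro n m a hnm
    rw [← Finset.sum_subset (Finset.Ico_subset_Ico_right hnm)]
    · refine Finset.sum_congr rfl fun j hj ↦ ?_
      rw [if_pos (Finset.mem_Ico.1 hj).2]
    · intro j hjm hjn
      have : ¬ j < n := fun h ↦ hjn (Finset.mem_Ico.2 ⟨(Finset.mem_Ico.1 hjm).1, h⟩)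
      rw [if_neg this, zero_smul]
  have hconv : Convex ℝ C := by
    rintro y ⟨n, hn, a, ha, rfl⟩ y' ⟨n', hn', a', ha', rfl⟩ t t' ht ht' htt'
    refine ⟨max n n', hn.trans (le_max_left _ _), fun j ↦ (t : ℂ) * (if j < n then a j else 0) +
      (t' : ℂ) * (if j < n' then a' j else 0), fun j ↦ ?_, ?_⟩
    · have h1' : ‖(if j < n then a j else 0 : ℂ)‖ ≤ 1 := by split_ifs <;> simp [ha j]
      have h2' : ‖(if j < n' then a' j else 0 : ℂ)‖ ≤ 1 := by split_ifs <;> simp [ha' j]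
      calc _ ≤ ‖(t : ℂ) * (if j < n then a j else 0)‖ + ‖(t' : ℂ) * (if j < n' then a' j else 0)‖ :=
            norm_add_le _ _
        _ ≤ t * 1 + t' * 1 := by
            rw [norm_mul, norm_mul, Complex.norm_real, Complex.norm_real, Real.norm_of_nonneg ht,
              Real.norm_of_nonneg ht']
            gcongr
        _ = 1 := by rw [mul_one, mul_one, htt']
    · rw [hpad a (le_max_left n n'), hpad a' (le_max_right n n'), Finset.smul_sum, Finset.smul_sum,
        ← Finset.sum_add_distrib]
      refine Finset.sum_congr rfl fun j _ ↦ ?_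
      rw [← Complex.coe_smul, ← Complex.coe_smul, smul_smul, smul_smul, ← add_smul]
  -- `z` is at distance `≥ ε` from `C`, hence not in its closure
  have hzC : z ∉ closure C := by
    have hsub : closure C ⊆ {y | ε ≤ ‖z - y‖} := by
      refine closure_minimal ?_ (isClosed_le continuous_const (continuous_const.sub continuous_id).norm)
      rintro y ⟨n, hn, a, ha, rfl⟩
      exact hcon n hn a ha
    intro hz
    have := hsub hz
    simp only [Set.mem_setOf_eq, sub_self, norm_zero] at this
    linarith
  -- Hahn–Banach, with a complex-linear functional, and its Riesz representative
  obtain ⟨f, u, hfC, hfz⟩ :=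
    RCLike.geometric_hahn_banach_closed_point (𝕜 := ℂ) hconv.closure isClosed_closure hzC
  set φ : H := (InnerProductSpace.toDual ℂ H).symm f with hφdef
  have hφ : ∀ y : H, ⟪φ, y⟫_ℂ = f y := fun y ↦ InnerProductSpace.toDual_symm_apply
  have h0C : (0 : H) ∈ C := ⟨N, le_rfl, fun _ ↦ 0, fun _ ↦ by simp, by simp⟩
  have hu0 : 0 < u := by simpa using hfC 0 (subset_closure h0C)
  have hφ0 : φ ≠ 0 := by
    intro h
    have : f z = 0 := by rw [← hφ, h, inner_zero_left]
    rw [this, map_zero] at hfz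
    linarith
  -- the adapted coefficients make the real part of `⟪φ, Σ a_j x_j⟫` equal to `Σ |⟪φ, x_j⟫|`
  set a : ℕ → ℂ := fun j ↦ if ⟪φ, x j⟫_ℂ = 0 then 0 else conj ⟪φ, x j⟫_ℂ / (‖⟪φ, x j⟫_ℂ‖ : ℂ)
    with ha_def
  have ha1 : ∀ j, ‖a j‖ ≤ 1 := by
    intro j
    simp only [ha_def]
    split_ifs with h
    · simp
    · rw [norm_div, Complex.norm_conj, Complex.norm_real, Real.norm_eq_abs,
        abs_of_nonneg (norm_nonneg _), div_self (norm_ne_zero_iff.2 h)]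
  have hare : ∀ j, re (a j * ⟪φ, x j⟫_ℂ) = ‖⟪φ, x j⟫_ℂ‖ := by
    intro j
    simp only [ha_def, RCLike.re_to_complex]
    split_ifs with h
    · rw [h]; simp
    · rw [div_mul_eq_mul_div, Complex.conj_mul', ← Complex.ofReal_pow, ← Complex.ofReal_div,
        Complex.ofReal_re, sq, mul_div_assoc, div_self (norm_ne_zero_iff.2 h), mul_one]
  have hbound : ∀ M : ℕ, ∑ j ∈ Finset.Ico N M, ‖⟪φ, x j⟫_ℂ‖ < u := by
    intro M
    rcases le_or_gt N M with hNM | hMN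
    · have hmem : ∑ j ∈ Finset.Ico N M, a j • x j ∈ C := ⟨M, hNM, a, ha1, rfl⟩
      have h := hfC _ (subset_closure hmem)
      rwa [← hφ, inner_sum, map_sum, Finset.sum_congr rfl (fun j _ ↦ by
        rw [inner_smul_right, hare j])] at h
    · rw [Finset.Ico_eq_empty_of_le hMN.le, Finset.sum_empty]; exact hu0
  -- hence `Σ |⟪φ, x_j⟫|` converges, contradicting (1)
  refine h1 φ hφ0 (summable_of_sum_range_le (c := u + ∑ j ∈ Finset.range N, ‖⟪φ, x j⟫_ℂ‖)
    (fun _ ↦ norm_nonneg _) fun M ↦ ?_)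
  rcases le_or_gt N M with hNM | hMN
  · rw [Finset.range_eq_Ico, ← Finset.sum_Ico_consecutive _ (Nat.zero_le N) hNM, ← Finset.range_eq_Ico]
    linarith [hbound M]
  · have : ∑ j ∈ Finset.range M, ‖⟪φ, x j⟫_ℂ‖ ≤ ∑ j ∈ Finset.range N, ‖⟪φ, x j⟫_ℂ‖ :=
      Finset.sum_le_sum_of_subset_of_nonneg (Finset.range_subset_range.2 hMN.le)
        fun _ _ _ ↦ norm_nonneg _
    linarith

/-! ### Proposition 11.10 -/

/-- **Proposition 11.10** (Bagchi; Bayart–Matheron). Let `(x_n)` be a sequence in a complex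
Hilbert space with `Σ_n ‖x_n‖² < ∞` and `Σ_n |⟪φ, x_n⟫| = ∞` for every `φ ≠ 0`. Then for every
`z`, `ε > 0` and `N₀` there are `n ≥ N₀` and unimodular `b_0, …, b_{n−1}` with
`‖z − Σ_{j<n} b_j x_j‖ < ε`; in particular the unimodular combinations are dense.
[cite: BayartMatheron2009, Prop. 11.10] -/
theorem exists_unimodular_sum_near (x : ℕ → H)
    (h1 : ∀ φ : H, φ ≠ 0 → ¬ Summable (fun n ↦ ‖⟪φ, x n⟫_ℂ‖))
    (h2 : Summable (fun n ↦ ‖x n‖ ^ 2)) (z : H) {ε : ℝ} (hε : 0 < ε) (N₀ : ℕ) :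
    ∃ n : ℕ, N₀ ≤ n ∧ ∃ b : ℕ → ℂ, (∀ j, ‖b j‖ = 1) ∧
      ‖z - ∑ j ∈ Finset.range n, b j • x j‖ < ε := by
  classical
  -- a tail with `Σ_{j≥N} ‖x_j‖² < (ε/2)²`, `N ≥ N₀`
  have htail := (tendsto_sum_nat_add fun n ↦ ‖x n‖ ^ 2)
  obtain ⟨N, hN⟩ := eventually_atTop.1 ((htail.eventually_lt_const (show (0 : ℝ) < (ε / 2) ^ 2 by
    positivity)).and (eventually_ge_atTop N₀))
  obtain ⟨hNt, hNN₀⟩ := hN N le_rfl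
  -- Lemma 11.11 for the target `z - Σ_{j<N} x_j`
  obtain ⟨n, hNn, a, ha, hclose⟩ := exists_sum_Ico_smul_near x h1
    (z - ∑ j ∈ Finset.range N, x j) (half_pos hε) N
  -- Lemma 11.12 on the block `N ≤ j < n`
  obtain ⟨b, hb, hbsq⟩ := exists_unimodular_norm_sq_le x a ha (Finset.Ico N n)
  have hblock : ∑ j ∈ Finset.Ico N n, ‖x j‖ ^ 2 < (ε / 2) ^ 2 := by
    have hs : Summable fun k : ℕ ↦ ‖x (k + N)‖ ^ 2 := h2.comp_injective (add_left_injective N)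
    calc ∑ j ∈ Finset.Ico N n, ‖x j‖ ^ 2 = ∑ k ∈ Finset.range (n - N), ‖x (k + N)‖ ^ 2 := by
          rw [Finset.sum_Ico_eq_sum_range]
          refine Finset.sum_congr rfl fun k _ ↦ by rw [add_comm]
      _ ≤ ∑' k : ℕ, ‖x (k + N)‖ ^ 2 := hs.sum_le_tsum _ fun k _ ↦ by positivity
      _ < (ε / 2) ^ 2 := hNt
  have hbd : ‖∑ j ∈ Finset.Ico N n, a j • x j - ∑ j ∈ Finset.Ico N n, b j • x j‖ < ε / 2 := by
    have := hbsq.trans_lt hblock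
    exact lt_of_pow_lt_pow_left₀ 2 (by positivity) this
  -- the final coefficients: `1` below `N`, `b_j` on the block
  refine ⟨n, hNN₀.trans hNn, fun j ↦ if j < N then 1 else b j, fun j ↦ ?_, ?_⟩
  · show ‖(if j < N then (1 : ℂ) else b j)‖ = 1
    split_ifs
    · simp
    · exact hb j
  have hsplit : ∑ j ∈ Finset.range n, (if j < N then 1 else b j) • x j =
      ∑ j ∈ Finset.range N, x j + ∑ j ∈ Finset.Ico N n, b j • x j := by
    rw [Finset.range_eq_Ico, Finset.range_eq_Ico, ← Finset.sum_Ico_consecutive _ (Nat.zero_le N) hNn]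
    congr 1
    · refine Finset.sum_congr rfl fun j hj ↦ ?_
      rw [if_pos (Finset.mem_Ico.1 hj).2, one_smul]
    · refine Finset.sum_congr rfl fun j hj ↦ ?_
      rw [if_neg (not_lt.2 (Finset.mem_Ico.1 hj).1)]
  rw [hsplit]
  calc ‖z - (∑ j ∈ Finset.range N, x j + ∑ j ∈ Finset.Ico N n, b j • x j)‖
      = ‖(z - ∑ j ∈ Finset.range N, x j - ∑ j ∈ Finset.Ico N n, a j • x j) +
          (∑ j ∈ Finset.Ico N n, a j • x j - ∑ j ∈ Finset.Ico N n, b j • x j)‖ := by abel_nf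
    _ ≤ ‖z - ∑ j ∈ Finset.range N, x j - ∑ j ∈ Finset.Ico N n, a j • x j‖ +
          ‖∑ j ∈ Finset.Ico N n, a j • x j - ∑ j ∈ Finset.Ico N n, b j • x j‖ := norm_add_le _ _
    _ < ε / 2 + ε / 2 := add_lt_add hclose hbd
    _ = ε := add_halves ε

end UnimodularCombinations

end Literature.Analysis.OperatorTheory
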